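import Literature.Computability.MetaComplexity.GraphOrderingPrincipleDegree
import HarnessLib

/-!
# The support closure of Galesi–Lauria (2010, §3 Def. 2, Facts 1–2, Lemmas 3–4)

Combinatorial core of Galesi–Lauria's degree lower bound for the graph ordering principle
`GOP(G)` (ACM ToCL 2010, Thm 1): the SUPPORT `Sup(U)` of a vertex set `U` in a graph `G` with
size parameter `r`.  GL10 Def. 2: "`A ;_U B` if `|B| ≤ r/2` and `Γ(B) ⊆ A ∪ U`"; `Sup(U)` is the
union of a maximal sequence `B₁, B₂, …` with `⋃_{j<i} B_j ;_U B_i`; Fact 1: this does not depend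
on the sequence.  We take the equivalent fixpoint form: `Sup(U)` is the LEAST set `S` that is
`U`-CLOSED (`|B| ≤ r/2 ∧ Γ(B) ⊆ S ∪ U ⇒ B ⊆ S`; GL10's maximal sequences produce exactly the least
closed set, which is the content of their Fact 1), and prove:

* `GOP.IsSupClosed`, `GOP.supp G r U` (= `Sup(U)`), leastness and closedness;
* `GOP.outerNeighbors_supp_subset` — Fact 2: `Γ(Sup(U)) ⊆ U`;
* `GOP.supp_mono`, `GOP.supp_union_supp` (`Sup(U ∪ Sup U) = Sup U`), `GOP.mem_supp_of_singleton`
  (`Γ({v}) ⊆ U ⇒ v ∈ Sup(U)` when `r ≥ 2`), `GOP.supp_empty` (`Sup(∅) = ∅` in an expander);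
* `GOP.two_mul_card_supp_le` — Lemma 3: in an `(r, c)`-vertex expander, `|U| ≤ cr/2 ⇒
  |Sup(U)| ≤ r/2`;
* `GOP.exists_adj_of_not_subset_supp` — Lemma 4: if `|A| ≤ r/2` and `A ⊄ Sup(U)` then there is an
  edge `{u, v}` with `v ∈ A ∖ Sup(U)` and `u ∉ Sup(U) ∪ A ∪ U`.

Source: N. Galesi, M. Lauria, *Optimality of size-degree tradeoffs for polynomial calculus*, ACM
ToCL 12(1) (2010), §3 pp. 9–11 [GalesiLauria2010] (held copy `paper:doi-10-1145-1838552-1838556`: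
Def. 2 and Facts 1–2 p0009–p0010, Lemma 3 p0010 L41–52, u-cta p0011 L12–17, Lemma 4 p0011 L18–23).
Design: `|B| ≤ r/2` is `2|B| ≤ r` on naturals; `Γ` is `outerNeighbors` and `(r,c)`-vertex
expanders are `IsVertexExpander` of `GraphOrderingPrincipleDegree.lean` (GL10 Def. 1).  Lemma 3
is proved through a maximal set `S` with `Γ(S) ⊆ U`, `2|S| ≤ r` (which is closed, hence contains
`Sup(U)`) instead of GL10's step count along a sequence — same expansion inequality.
-/

namespace Literature.Computability.MetaComplexity

namespace GOP

open Finset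

variable {V : Type*} [Fintype V] [DecidableEq V] (G : SimpleGraph V) [DecidableRel G.Adj] (r : ℕ)

/-- `S` is `U`-CLOSED: every `B` with `|B| ≤ r/2` and `Γ(B) ⊆ S ∪ U` lies inside `S` (the sets
that no inference `S ;_U B` can enlarge). [Galesi–Lauria 2010, Def. 2]
[cite: GalesiLauria2010, Definition 2] -/
def IsSupClosed (U S : Finset V) : Prop :=
  ∀ B : Finset V, 2 * B.card ≤ r → outerNeighbors G B ⊆ S ∪ U → B ⊆ S

/-- **The support `Sup(U)`**: the least `U`-closed vertex set (the intersection of all of them;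
GL10 define it as the union of a maximal inference sequence, Fact 1 = independence of the
sequence). [Galesi–Lauria 2010, Def. 2] [cite: GalesiLauria2010, Definition 2] -/
noncomputable def supp (U : Finset V) : Finset V :=
  by classical exact Finset.univ.filter fun v => ∀ S : Finset V, IsSupClosed G r U S → v ∈ S

variable {G r}

/-- Membership in `Sup(U)`. [Galesi–Lauria 2010, Def. 2] [cite: GalesiLauria2010, Definition 2] -/
theorem mem_supp {U : Finset V} {v : V} :
    v ∈ supp G r U ↔ ∀ S : Finset V, IsSupClosed G r U S → v ∈ S := by
  classical
  simp [supp]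

/-- `Sup(U)` is contained in every `U`-closed set (Fact 1: every maximal sequence stays inside).
[Galesi–Lauria 2010, Fact 1] [cite: GalesiLauria2010, Fact 1] -/
theorem supp_subset_of_isSupClosed {U S : Finset V} (h : IsSupClosed G r U S) : supp G r U ⊆ S :=
  fun _ hv => mem_supp.1 hv S h

/-- `Sup(U)` is itself `U`-closed (maximality of the sequence). [Galesi–Lauria 2010, Def. 2 /
Fact 1] [cite: GalesiLauria2010, Fact 1] -/
theorem isSupClosed_supp (U : Finset V) : IsSupClosed G r U (supp G r U) := by
  intro B hB hΓ v hv
  refine mem_supp.2 fun S hS => hS B hB (hΓ.trans ?_) hv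
  exact Finset.union_subset_union (supp_subset_of_isSupClosed hS) Finset.Subset.rfl

/-- **Fact 2**: `Γ(Sup(U)) ⊆ U`. [Galesi–Lauria 2010, Fact 2] [cite: GalesiLauria2010, Fact 2] -/
theorem outerNeighbors_supp_subset (U : Finset V) : outerNeighbors G (supp G r U) ⊆ U := by
  classical
  intro w hw
  by_contra hwU
  rw [mem_outerNeighbors] at hw
  obtain ⟨hwS, v₀, hv₀, hadj⟩ := hw
  -- remove from `Sup(U)` all neighbours of `w`: the result is still closed
  set S'' := (supp G r U).filter fun v => ¬ G.Adj v w with hS''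
  have hclosed : IsSupClosed G r U S'' := by
    intro B hB hΓ
    have hBS : B ⊆ supp G r U :=
      isSupClosed_supp U B hB (hΓ.trans (Finset.union_subset_union (Finset.filter_subset _ _)
        Finset.Subset.rfl))
    intro v hv
    refine Finset.mem_filter.2 ⟨hBS hv, fun hvw => ?_⟩
    have hwB : w ∈ outerNeighbors G B :=
      (mem_outerNeighbors G).2 ⟨fun h => hwS (hBS h), v, hv, hvw⟩
    rcases Finset.mem_union.1 (hΓ hwB) with h | h
    · exact hwS (Finset.mem_filter.1 h).1
    · exact hwU h
  have := Finset.mem_filter.1 (supp_subset_of_isSupClosed hclosed hv₀)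
  exact this.2 hadj

/-- `Sup` is monotone in `U`. [Galesi–Lauria 2010, §3 ("by monotonicity of Sup")]
[cite: GalesiLauria2010, Lemma 2] -/
theorem supp_mono {U U' : Finset V} (h : U ⊆ U') : supp G r U ⊆ supp G r U' := by
  refine supp_subset_of_isSupClosed fun B hB hΓ => isSupClosed_supp U' B hB (hΓ.trans ?_)
  exact Finset.union_subset_union Finset.Subset.rfl h

/-- `Sup(U ∪ Sup(U)) = Sup(U)` (used as "`Sup(rᵢ) ⊆ Sup(xt)`" in GL10's proof of Lemma 2).
[Galesi–Lauria 2010, proof of Lemma 2 (16)] [cite: GalesiLauria2010, Lemma 2] -/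
theorem supp_union_supp (U : Finset V) : supp G r (U ∪ supp G r U) = supp G r U := by
  refine Finset.Subset.antisymm ?_ (supp_mono Finset.subset_union_left)
  refine supp_subset_of_isSupClosed fun B hB hΓ => isSupClosed_supp U B hB (hΓ.trans ?_)
  intro w hw
  rcases Finset.mem_union.1 hw with h | h
  · exact Finset.mem_union_left _ h
  · rcases Finset.mem_union.1 h with h | h
    · exact Finset.mem_union_right _ h
    · exact Finset.mem_union_left _ h

/-- If `U' ⊆ U ∪ Sup(U)` then `Sup(U') ⊆ Sup(U)`. [Galesi–Lauria 2010, proof of Lemma 2 (14)–(16)]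
[cite: GalesiLauria2010, Lemma 2] -/
theorem supp_subset_supp_of_subset_union {U U' : Finset V} (h : U' ⊆ U ∪ supp G r U) :
    supp G r U' ⊆ supp G r U :=
  (supp_mono h).trans (supp_union_supp U).subset

/-- `Γ({v})` is the neighbourhood of `v`. [folklore] -/
theorem mem_outerNeighbors_singleton {v w : V} : w ∈ outerNeighbors G {v} ↔ G.Adj v w := by
  rw [mem_outerNeighbors]
  constructor
  · rintro ⟨-, u, hu, h⟩
    rw [Finset.mem_singleton] at hu
    exact hu ▸ h
  · intro h
    exact ⟨fun hw => G.ne_of_adj h (Finset.mem_singleton.1 hw).symm, v, Finset.mem_singleton_self _,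
      h⟩

/-- A vertex all of whose neighbours lie in `U` belongs to `Sup(U)` (as `{v}` is an admissible
`B` once `r ≥ 2`; "since `Γ(v) ⊆ Vertex(t)`, then `v ∈ Sup(t)`"). [Galesi–Lauria 2010, proof of
Lemma 2, Requirement 1] [cite: GalesiLauria2010, Lemma 2] -/
theorem mem_supp_of_singleton (hr : 2 ≤ r) {U : Finset V} {v : V}
    (h : outerNeighbors G {v} ⊆ U) : v ∈ supp G r U := by
  have := isSupClosed_supp (G := G) (r := r) U {v} (by simpa using hr)
    (h.trans Finset.subset_union_right)
  exact this (Finset.mem_singleton_self v)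

/-- In an `(r, c)`-vertex expander with `c > 0`, `Sup(∅) = ∅` ("the support of a constant
polynomial is the empty set"). [Galesi–Lauria 2010, proof of Lemma 2, Requirement 3]
[cite: GalesiLauria2010, Lemma 2] -/
theorem supp_empty {c : ℝ} (hexp : IsVertexExpander G r c) (hc : 0 < c) :
    supp G r (∅ : Finset V) = ∅ := by
  refine Finset.subset_empty.1 (supp_subset_of_isSupClosed fun B hB hΓ => ?_)
  rw [Finset.union_empty, Finset.subset_empty] at hΓ
  by_contra hBne
  have hBpos : 0 < B.card := Finset.card_pos.2 (Finset.nonempty_iff_ne_empty.2 fun h =>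
    hBne (h ▸ Finset.Subset.rfl))
  have h1 := hexp B (by omega)
  rw [hΓ, Finset.card_empty, Nat.cast_zero] at h1
  have : (0 : ℝ) < c * B.card := mul_pos hc (by exact_mod_cast hBpos)
  linarith

/-- **Lemma 3**: in an `(r, c)`-vertex expander, a set `U` with `|U| ≤ cr/2` has `|Sup(U)| ≤ r/2`
("if the size of `Sup(U)` is bigger than `r/2`, then there is a step where `r/2` is overcome …").
[Galesi–Lauria 2010, Lemma 3] [cite: GalesiLauria2010, Lemma 3] -/
theorem two_mul_card_supp_le {c : ℝ} (hexp : IsVertexExpander G r c) (hc : 0 < c) {U : Finset V}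
    (hU : (U.card : ℝ) ≤ c * r / 2) : 2 * (supp G r U).card ≤ r := by
  classical
  -- a largest set `S` with `Γ(S) ⊆ U` and `2|S| ≤ r`
  set P : Finset (Finset V) := Finset.univ.filter fun S => outerNeighbors G S ⊆ U ∧ 2 * S.card ≤ r
    with hP
  have hPne : P.Nonempty := ⟨∅, by simp [hP, outerNeighbors]⟩
  obtain ⟨S, hSP, hSmax⟩ := Finset.exists_max_image P Finset.card hPne
  obtain ⟨hSΓ, hScard⟩ := (Finset.mem_filter.1 hSP).2
  -- `S` is closed
  have hclosed : IsSupClosed G r U S := by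
    intro B hB hΓ
    set S' := S ∪ B with hS'
    have hS'Γ : outerNeighbors G S' ⊆ U := by
      intro w hw
      rw [mem_outerNeighbors] at hw
      obtain ⟨hwS', v, hv, hadj⟩ := hw
      rw [hS', Finset.mem_union, not_or] at hwS'
      rcases Finset.mem_union.1 hv with hv | hv
      · exact hSΓ ((mem_outerNeighbors G).2 ⟨hwS'.1, v, hv, hadj⟩)
      · have := hΓ ((mem_outerNeighbors G).2 ⟨hwS'.2, v, hv, hadj⟩)
        rcases Finset.mem_union.1 this with h | h
        · exact absurd h hwS'.1
        · exact h
    have hS'le : S'.card ≤ r := (Finset.card_union_le S B).trans (by omega)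
    have hexpS' := hexp S' hS'le
    have h2 : (S'.card : ℝ) ≤ r / 2 := by
      have := (hexpS'.trans (by exact_mod_cast Finset.card_le_card hS'Γ)).trans hU
      nlinarith
    have hS'card : 2 * S'.card ≤ r := by
      have : (2 * S'.card : ℝ) ≤ r := by linarith
      exact_mod_cast this
    have hS'P : S' ∈ P := Finset.mem_filter.2 ⟨Finset.mem_univ _, hS'Γ, hS'card⟩
    have hle := hSmax S' hS'P
    have heq : S = S' := Finset.eq_of_subset_of_card_le Finset.subset_union_left hle
    rw [heq]
    exact Finset.subset_union_right
  have := Finset.card_le_card (supp_subset_of_isSupClosed hclosed)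
  omega

/-- **Lemma 4**: if `|A| ≤ r/2` and `A ⊄ Sup(U)` then some edge `{u, v}` has `v ∈ A ∖ Sup(U)` and
`u ∉ Sup(U) ∪ A ∪ U`. [Galesi–Lauria 2010, Lemma 4] [cite: GalesiLauria2010, Lemma 4] -/
theorem exists_adj_of_not_subset_supp {U A : Finset V} (hA : 2 * A.card ≤ r)
    (hAS : ¬ A ⊆ supp G r U) :
    ∃ u v, G.Adj u v ∧ v ∈ A ∧ v ∉ supp G r U ∧ u ∉ supp G r U ∧ u ∉ A ∧ u ∉ U := by
  have hΓ : ¬ outerNeighbors G A ⊆ supp G r U ∪ U := fun h => hAS (isSupClosed_supp U A hA h)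
  obtain ⟨u, huA, hu⟩ := Finset.not_subset.1 hΓ
  rw [Finset.mem_union, not_or] at hu
  rw [mem_outerNeighbors] at huA
  obtain ⟨huA', v, hvA, hadj⟩ := huA
  refine ⟨u, v, hadj.symm, hvA, fun hvS => hu.1 ?_, hu.1, huA', hu.2⟩
  -- `v ∈ Sup(U)` and `u ∉ Sup(U)` adjacent would put `u ∈ Γ(Sup(U)) ⊆ U`
  exfalso
  have : u ∈ outerNeighbors G (supp G r U) := (mem_outerNeighbors G).2 ⟨hu.1, v, hvS, hadj⟩
  exact hu.2 (outerNeighbors_supp_subset U this)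

end GOP

end Literature.Computability.MetaComplexity
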